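import Summits.Ventures.PercRepro0.DualCrossing
import Summits.Ventures.PercRepro0.Coupling

/-!
# T2 · PLANAR-ASSEMBLY in Lean, conditional on P1 and P5 only (seat p1, gen 1)

Assembly, on the cell's `Defs.lean`, of the planar block's Lean twins (OFF the declaration path, lead
23:00:52Z):

* `half_le_P_LR`: `½ ≤ P_½(LR_n)` for every `n` — from `LR_or_dual` (P6 «at least one», DualCrossing.lean)
  and the self-duality `P_½(dualConfig⁻¹ LR_n) = P_½(LR_n)` (DualMap.lean): `1 ≤ P_½(LR_n) + P_½(dualConfig⁻¹ LR_n) = 2 P_½(LR_n)`.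
  (The paper's Theorem 4.4 gives the equality `P_½(LR_n) = ½`; the inequality is all that T2 uses.)
* `T2_Planar_of_P1_P5`: `T2_Planar` (`θ_2(p_c(2)) = 0 ∧ p_c(2) = ½`) from P1 HARRIS and P5 SHARPNESS alone —
  the monotonicity of `θ_2` (L1, p5's `monotoneOn_theta`) and `θ_2(1) = 1` (p5's `theta_one`) are already in
  Lean, and the crossing bound of T2-assembly-p4-v2 §4 Step 2 is `Crossing.lean` + this file.

Imports only landed PercRepro0 modules (which import Mathlib). No definitions, no instances, no axioms.
-/

namespace Summit.Ventures.PercRepro0.T2Twin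

open Summit.Ventures.PercRepro0.Defs Summit.Ventures.PercRepro0.Crossing
  Summit.Ventures.PercRepro0.DualMap Summit.Ventures.PercRepro0.DualCrossing
open MeasureTheory ProbabilityTheory unitInterval Set
open scoped ENNReal

/-- `1 ≤ 2 · P_½(LR_n)`: the configuration or its dual crosses, and the dual has the same law. -/
theorem one_le_two_mul_P_LR (n : ℕ) : (1 : ℝ≥0∞) ≤ 2 * P 2 (clamp (1 / 2)) (LR n) := by
  have hcover : (Set.univ : Set (Config 2)) ⊆ LR n ∪ dualConfig ⁻¹' LR n := by
    intro ω _
    rcases LR_or_dual n ω with h | h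
    · exact Or.inl h
    · exact Or.inr h
  calc (1 : ℝ≥0∞) = P 2 (clamp (1 / 2)) Set.univ := measure_univ.symm
    _ ≤ P 2 (clamp (1 / 2)) (LR n ∪ dualConfig ⁻¹' LR n) := measure_mono hcover
    _ ≤ P 2 (clamp (1 / 2)) (LR n) + P 2 (clamp (1 / 2)) (dualConfig ⁻¹' LR n) := measure_union_le _ _
    _ = 2 * P 2 (clamp (1 / 2)) (LR n) := by
        rw [P_half_preimage_dualConfig (measurableSet_LR n), two_mul]

/-- **The crossing lower bound at `½`** (P6-dualcrossing-p1-v1 Theorem 4.4, inequality form):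
`½ ≤ P_½(LR_n)` for every `n`. -/
theorem half_le_P_LR (n : ℕ) : (1 : ℝ) / 2 ≤ (P 2 (clamp (1 / 2)) (LR n)).toReal := by
  have h := one_le_two_mul_P_LR n
  have hfin : 2 * P 2 (clamp (1 / 2)) (LR n) ≠ ⊤ := ENNReal.mul_ne_top (by simp) (measure_ne_top _ _)
  have h' := ENNReal.toReal_mono hfin h
  rw [ENNReal.toReal_mul, ENNReal.toReal_one] at h'
  have h2 : ((2 : ℝ≥0∞)).toReal = 2 := by simp
  rw [h2] at h'
  linarith

/-- PlanarT2's crossing-bound hypothesis, discharged: `½ ≤ (n+1) · P_½(0 ↔ ∂Λ_{n+1})` for all `n ≥ 1`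
(T2-assembly-p4-v2 §4 Step 2, unconditional by-product Remark 5.1). -/
theorem hcross_holds : ∀ n : ℕ, 1 ≤ n →
    (1 : ℝ) / 2 ≤ ((n : ℝ) + 1) * (P 2 (clamp (1 / 2)) (toBoundary 2 (n + 1))).toReal :=
  hcross_of_LR fun n _ => half_le_P_LR n

/-- **T2 · PLANAR-ASSEMBLY, Lean twin conditional on P1 and P5 only**: `θ_2(p_c(2)) = 0` and `p_c(2) = ½`
from P1 HARRIS (`θ_2(½) = 0`) and P5 SHARPNESS (exponential decay below `p_c(2)`). -/
theorem T2_Planar_of_P1_P5 (hP1 : P1_Harris) (hP5 : P5_Sharpness 2) : T2_Planar :=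
  T2_Planar_of_LR monotoneOn_theta (by rw [theta_one (by norm_num)]; exact one_pos) hP1 hP5
    fun n _ => half_le_P_LR n

/-- `T(2)` alone (`θ_2(p_c(2)) = 0`) from P1 and P5. -/
theorem T_two_of_P1_P5 (hP1 : P1_Harris) (hP5 : P5_Sharpness 2) : T 2 :=
  (T2_Planar_of_P1_P5 hP1 hP5).1

end Summit.Ventures.PercRepro0.T2Twin
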